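import Summits.HodgeConjecture.HodgeConjecture.Theorems.R90S6EtaOneGraphPartner        -- ★ W10 (p06): `etaOneGraphPartnerAlgHom` (= η̂₁), `graph_etaOneGraphPartnerAlgHom`
import Summits.HodgeConjecture.HodgeConjecture.Theorems.R90S6SatakeCoeffBCPartner      -- ★ TB3 (p04): brings ★ B3 (`prod_zpow_param_two`, `laurentEvalAt_eq_laurentEvalAt_line_two`), ★ `eq_of_forall_laurentEvalAt_eq`, ★ `eq_linear_two_of_rev`
import HarnessLib

/-!
# R90 · S6 «Ch. 14.1–14.5 stable trace formula» — card TE3 (DAG row E1.4.4.3.1): SATAKE COEFFICIENTS OF `η̂₁` ON THE NORM FIBRE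
# `(𝒮(η̂₁ φ))_{ℓ′_k} = Σ_{μ : μ₀ − μ₂ = k} (𝒮^{GL}_{wt} φ)_μ` for all `k ∈ ℤ` — UNSIGNED (`Theorems/R90S6SatakeCoeffEtaOnePartner.lean`)

Cell `hodgecm-mathlib`, crux H413 (`stmt-HodgeConjecture-24833`), route of record `HCCMUnconditional`; programme R90-TF (brief `director/R90-BRIEF.v2.md`
1f40d54518340a35), section S6 (base `R90-C14`, dealer R90-C14-plan (g2)), seat R90-C14-p04 (g2); CARD TE3 dealt BY NAME 2026-09-05T01:34:52Z (R90 bus), third of the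
coefficient dictionaries ★ B3 (`ξ̂_H`, `R90S6SatakeCoeffGraphPartner`) ∕ ★ TB3 (`ψ̂_G`, `R90S6SatakeCoeffBCPartner`).  Lane `--kind proof --supports stmt-HodgeConjecture-24833
--as helper`; THEOREMS ONLY over ★ `Theorems` ∕ Literature ∕ Mathlib carriers (no definition, no instance, no notation, no named fact, no kit, no `sorry`).

## THE PRINT
[Rogawski1990, §4.10 p. 57, Prop. 4.10.1 (b) p. 58, Prop. 4.10.2 pp. 58–59]: `η̂₁ : ℋ(G̃, ω̃) → ℋ(H, ω)` is the unramified Hecke map of the twisted-endoscopic embedding `η₁`;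
`Tr(π̃(φ)π̃(ε)) = Tr(i_H(χ)(η̂₁ φ))` with the SAME `χ` (no `μ`-shift), so its Satake graph is `λ^{GL₃}_{(z,1,z⁻¹)}(φ) = λ^{U(2)}_{(z,1)}(η̂₁ φ)` for all `z ∈ ℂˣ` — the tree's ★ W10
`etaOneGraphPartnerAlgHom` IS this map, DEFINED by that graph (★ `graph_etaOneGraphPartnerAlgHom`, the UNSIGNED literal of record; its relation to `ξ̂_H ∘ ψ̂_G` by the
involution `z ↦ −z` is ★ W10 (E.6) ∕ W10-i).  [CartierCorvallis1979, §IV (4.2)–(4.4)]: `λ_β(f) = (𝒮f)(β)`; on exponents the `GL₃` parameter `(z,1,z⁻¹)` reads `x^μ ↦ z^{μ₀−μ₂}`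
(the norm fibre `μ ↦ μ₀ − μ₂`), the `U(1,1)` parameter `(z,1)` reads `x^{ℓ′_k} ↦ z^k` on the line `ℓ′_k = (k, −k)` which supports `𝒮(η̂₁φ)` (antisymmetry); comparing
coefficients gives the HEAD, with NO sign: the `(−1)^k` of `ξ̂_H` (★ B3) and the `(−1)^k` of the involution `τ` cancel in `η̂₁ = τ ∘ ξ̂_H ∘ ψ̂_G`.  The `δ^{1∕2}`-weights sit
inside both transforms (`wt` ∕ `satakeWeight`), so no stray factor.

## WHAT IS PROVED
* §1 **`laurentEvalAt_bcLine_eq_laurentEvalAt_normFibre_two`** — for every `P ∈ ℂ[ℤ³]`: `ev_{(z,1,z⁻¹)}(P) = ev_{(z,1)}(Σ_{μ ∈ supp P} x^{ℓ′_{μ₀−μ₂}} · P_μ)`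
  (the base-change line = the norm fibre-sum pushed onto the `U(1,1)` line; twin of ★ TB3 `laurentEvalAt_bcLine_eq_laurentEvalAt_normFibre`).
* §2 HEAD **`coeff_satakeTransform_etaOneGraphPartner`** (adic place `w ∣ v` inert, `E_w∕F_v` unramified; `U`-binders `c hc1 v w hw hv` = ★ W3 ∕ W10, ANY datum `hd`; `GL`-binders
  = ★ W7-b ∕ W10 VERBATIM): for every `φ ∈ ℋ(GL₃(K), GL₃(𝒪))` and every `k ∈ ℤ`,
  `(hd.satakeTransform (η̂₁ φ))_{ℓ′_k} = Σ_{μ ∈ supp(𝒮^{GL}_{wt} φ), μ₀ − μ₂ = k} (𝒮^{GL}_{wt} φ)_μ`.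
  Proof = ★ TB3's transport pattern with `2 ↤ 3` on the unitary side: ★ graph through `laurentEvalAt` (GL side by `rfl`, U side by ★ `unitaryHeckeEigencharacterAdic_eq` + ★
  `heckeEigencharacter_apply`) + §1, line-to-torus by ★ B3 `laurentEvalAt_eq_laurentEvalAt_line_two`, equality by ★ `eq_of_forall_laurentEvalAt_eq`, coefficient at `ℓ′_k`.
HONEST LABEL: local Hecke coefficient algebra over ★ carriers; proves no printed global statement and no orbital-integral identity (the twisted-endoscopic FL for `η̂₁` stays
FLOOR), discharges no citation; count-neutral helper until row E1.4.4.3.1 consumes it.  HC_CM is proved only modulo the 7 printed citations (2 remaining named inputs: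
hLiu418 = stmt-HodgeConjecture-24832, h413 = stmt-HodgeConjecture-24833) until rung 0 closes; REL ≠ ★ ≠ BUILT.

## Tree search (dedup)
`rg "SatakeCoeffEtaOnePartner|coeff_satakeTransform_etaOneGraphPartner|normFibre_two"` over `lean/` — no hit (2026-09-05T01:36Z); REUSED ★: `graph_etaOneGraphPartnerAlgHom`
[R90S6EtaOneGraphPartner :166], B3 `prod_zpow_param_two` ∕ `laurentEvalAt_eq_laurentEvalAt_line_two`, `eq_of_forall_laurentEvalAt_eq`, `coeff_satakeTransform_eq_zero_of_ne_neg`,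
`eq_linear_two_of_rev`, `unitaryHeckeEigencharacterAdic_eq`, `heckeEigencharacter_apply` (U and GL).

## References
* [Rogawski1990] J. D. Rogawski, *Automorphic Representations of Unitary Groups in Three Variables*, Ann. of Math. Stud. 123 (1990): §4.8 p. 54 (`η₁`), §4.10 p. 57,
  Prop. 4.10.1 (b), Prop. 4.10.2 pp. 58–59.
* [CartierCorvallis1979] P. Cartier, *Representations of 𝔭-adic groups: a survey*, PSPM 33.1 (1979): §IV (4.2)–(4.4), Thm. 4.1, Cor. 4.2.
-/

set_option autoImplicit false
-- the mandated namespace repeats the single-problem summit's segment (`HodgeConjecture.HodgeConjecture`)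
set_option linter.dupNamespace false

noncomputable section

open scoped Valued WithZero Matrix MatrixGroups
open NumberField IsDedekindDomain ValuativeRel
open Literature.NumberTheory.Automorphic Literature.NumberTheory.Automorphic.HermitianLattice Literature.NumberTheory.Automorphic.UnitaryGroup

namespace Summit.HodgeConjecture.HodgeConjecture.R90.S6

universe u

/-! ## §1 The base-change line of `ℂ[ℤ³]` as the norm fibre-sum on the `U(1,1)` line -/

section Line

/-- **`ev_{(z,1,z⁻¹)}(P) = ev_{(z,1)}(Σ_{μ ∈ supp P} x^{ℓ′_{μ₀−μ₂}}·P_μ)` for every `P ∈ ℂ[ℤ³]`**: the `GL₃` base-change parameter reads `x^μ ↦ z^{μ₀−μ₂}`, and the `U(1,1)` parameter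
`(z, 1)` reads `x^{ℓ′_k} ↦ z^k` (`ℓ′_k = (k, −k)`, ★ B3 `prod_zpow_param_two`), so the restriction of a `GL₃` Laurent polynomial to the base-change line is its NORM-FIBRE SUM pushed
onto the `U(1,1)` line (★ TB3 `laurentEvalAt_bcLine_eq_laurentEvalAt_normFibre` is the `U(3)`-line twin). [cite: Rogawski1990, §4.10 Prop. 4.10.2 pp. 58–59]
[cite: CartierCorvallis1979, §IV (4.2)] -/
theorem laurentEvalAt_bcLine_eq_laurentEvalAt_normFibre_two (P : AddMonoidAlgebra ℂ (Fin 3 → ℤ)) (z : ℂˣ) :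
    laurentEvalAt ![z, 1, z⁻¹] P =
      laurentEvalAt ![z, 1] (∑ μ ∈ P.coeff.support,
        AddMonoidAlgebra.single (fun i : Fin 2 => (μ 0 - μ 2) * (1 - 2 * ((i : ℕ) : ℤ))) (P.coeff μ)) := by
  classical
  conv_lhs => rw [← AddMonoidAlgebra.sum_coeff_single P, map_finsuppSum, Finsupp.sum]
  rw [map_sum]
  refine Finset.sum_congr rfl fun μ _ => ?_
  rw [laurentEvalAt_single, laurentEvalAt_single, prod_zpow_param_two, Fin.prod_univ_three]
  simp only [Fin.isValue, Fin.val_zero, Nat.cast_zero, mul_zero, sub_zero, mul_one, Matrix.cons_val_zero, Matrix.cons_val_one, Matrix.cons_val_two,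
    Matrix.tail_cons, Matrix.head_cons, Units.val_one, one_zpow, Units.val_inv_eq_inv_val, inv_zpow', zpow_sub₀ (Units.ne_zero z), div_eq_mul_inv,
    zpow_neg]

end Line

/-! ## §2 The Satake coefficients of `η̂₁ φ` are the norm-fibre sums of the `GL₃` Satake coefficients of `φ` -/

section Adic

variable {F E : Type} [Field F] [NumberField F] [Field E] [NumberField E] [Algebra F E] [Algebra.IsQuadraticExtension F E]
  (c : E ≃ₐ[F] E) (hc1 : c ≠ 1) (v : HeightOneSpectrum (𝓞 F)) (w : PlacesOver E v) (hw : c • w.1 = w.1)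
  (hv : Algebra.IsUnramifiedIn (𝓞 E) v.asIdeal)
  {K : Type u} [Field K] [ValuativeRel K] [IsDiscreteValuationRing 𝒪[K]] [Finite 𝓀[K]] {ϖ : K}
  [IsHeckeTriple (⊤ : Submonoid (GL (Fin 3) K)) (glInt 3 K) (glInt 3 K)]
  (hϖ : IsUniformizingElement ϖ) {u : ℂˣ} (hu : (u : ℂ) ^ 2 = ((Nat.card 𝓀[K] : ℕ) : ℂ))
  {wt : Multiplicative (Fin 3 → ℤ) →* ℂ}
  (hwt : ∀ e : Fin 3 → ℤ, wt (Multiplicative.ofAdd e) = ((u ^ ((((3 : ℕ) : ℤ) - 1) * (∑ i, e i) - 2 * satakeTwistExp e) : ℂˣ) : ℂ))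

-- (raised heartbeat budget: the adic `heckeAlgebra` carrier at `E_w` vs the generic-`K` carrier of the ★ Satake files agree only up to instance-path unfolding; each such
--  unification is costly — as in ★ W3-a, ★ B3, ★ TB3; 400000 measured insufficient there; no `decide`, no search)
set_option maxHeartbeats 800000 in
/-- **TE3 HEAD — SATAKE COEFFICIENTS OF `η̂₁` ON THE NORM FIBRE (UNSIGNED).**  At an inert place `w ∣ v` with `E_w∕F_v` unramified, for every `φ ∈ ℋ(GL₃(K), GL₃(𝒪))` (the `GL`-side
over any DVR field `K` with the `δ^{1∕2}`-weight `wt` of ★ W7-b ∕ W10), every unramified datum `hd` at `w` and every `k ∈ ℤ`: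
`(𝒮(η̂₁ φ))_{ℓ′_k} = Σ_{μ ∈ supp(𝒮^{GL}_{wt} φ), μ₀ − μ₂ = k} (𝒮^{GL}_{wt} φ)_μ`, `ℓ′_k = (k, −k)` — the `U(1,1)` Satake coefficient of `η̂₁φ` is the NORM-FIBRE SUM of the `GL₃` Satake
coefficients, with no sign (print: `Tr(π̃(φ)π̃(ε)) = Tr(i_H(χ)(η̂₁φ))` with the same `χ`).  Proof: ★ `graph_etaOneGraphPartnerAlgHom` read through `laurentEvalAt`, §1, ★ B3
`laurentEvalAt_eq_laurentEvalAt_line_two`, ★ `eq_of_forall_laurentEvalAt_eq`, coefficient at `ℓ′_k`.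
[cite: Rogawski1990, §4.10 p. 57, Prop. 4.10.1 (b), Prop. 4.10.2 pp. 58–59] [cite: CartierCorvallis1979, §IV (4.2)–(4.4), Thm. 4.1, Cor. 4.2] -/
theorem coeff_satakeTransform_etaOneGraphPartner {ϖE : w.1.adicCompletion E}
    (hd : UnramifiedLocalConjDatum (galAdicCompletionMap (L := E) c hw) ϖE) (φ : heckeAlgebra ℂ (GL (Fin 3) K) (glInt 3 K)) (k : ℤ) :
    (hd.satakeTransform (etaOneGraphPartnerAlgHom c hc1 v w hw hv hϖ hu hwt φ)).coeff (fun i : Fin 2 => k * (1 - 2 * ((i : ℕ) : ℤ))) =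
      ∑ μ ∈ ((isIwasawaExponent_gl (n := 3) hϖ).satakeTransform wt φ).coeff.support with μ 0 - μ 2 = k,
        ((isIwasawaExponent_gl (n := 3) hϖ).satakeTransform wt φ).coeff μ := by
  classical
  haveI := finite_residueField_adicCompletion E w.1
  set P := (isIwasawaExponent_gl (n := 3) hϖ).satakeTransform wt φ with hP
  set F₂ := hd.satakeTransform (etaOneGraphPartnerAlgHom c hc1 v w hw hv hϖ hu hwt φ) with hF₂
  -- the `U(1,1)` Satake transform is supported on the line `ℓ′_k`
  have hanti : ∀ μ, F₂.coeff μ ≠ 0 → μ = fun i : Fin 2 => μ 0 * (1 - 2 * ((i : ℕ) : ℤ)) := fun μ hμ =>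
    eq_linear_two_of_rev μ fun i => by
      by_contra hne
      exact hμ (hd.coeff_satakeTransform_eq_zero_of_ne_neg _ hne)
  -- the norm-fibre transport of the `GL₃` Satake polynomial onto the `U(1,1)` line
  set G : AddMonoidAlgebra ℂ (Fin 2 → ℤ) :=
    ∑ μ ∈ P.coeff.support, AddMonoidAlgebra.single (fun i : Fin 2 => (μ 0 - μ 2) * (1 - 2 * ((i : ℕ) : ℤ))) (P.coeff μ) with hG
  have hsuppG : ∀ ν, G.coeff ν ≠ 0 → ν = fun i : Fin 2 => ν 0 * (1 - 2 * ((i : ℕ) : ℤ)) := by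
    intro ν hν
    rw [hG, AddMonoidAlgebra.coeff_sum, Finsupp.finsetSum_apply] at hν
    obtain ⟨μ, -, hμν⟩ := Finset.exists_ne_zero_of_sum_ne_zero hν
    rw [AddMonoidAlgebra.coeff_single, Finsupp.single_apply] at hμν
    split_ifs at hμν with hμ
    · rw [← hμ]
      funext i
      simp only [Fin.isValue, Fin.val_zero, Nat.cast_zero, mul_zero, sub_zero, mul_one]
    · exact absurd rfl hμν
  -- the graph identity: `ev_{(z,1)} F₂ = ev_{(z,1,z⁻¹)} P = ev_{(z,1)} G`
  have hgraph : ∀ z : ℂˣ, laurentEvalAt ![z, 1] F₂ = laurentEvalAt ![z, 1] G := by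
    intro z
    have hg := graph_etaOneGraphPartnerAlgHom c hc1 v w hw hv hϖ hu hwt φ z
    rw [unitaryHeckeEigencharacterAdic_eq c hc1 v w hw hv hd, hd.heckeEigencharacter_apply,
      (isIwasawaExponent_gl (n := 3) hϖ).heckeEigencharacter_apply] at hg
    rw [hG, ← laurentEvalAt_bcLine_eq_laurentEvalAt_normFibre_two P z]
    exact hg.symm
  -- hence `F₂ = G`
  have hFG : F₂ = G :=
    eq_of_forall_laurentEvalAt_eq fun β => by
      rw [laurentEvalAt_eq_laurentEvalAt_line_two F₂ hanti β, laurentEvalAt_eq_laurentEvalAt_line_two G hsuppG β, hgraph]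
  -- read off the coefficient at `ℓ′_k`
  rw [hFG, hG, AddMonoidAlgebra.coeff_sum, Finsupp.finsetSum_apply, Finset.sum_filter]
  refine Finset.sum_congr rfl fun μ _ => ?_
  rw [AddMonoidAlgebra.coeff_single, Finsupp.single_apply]
  by_cases hk : μ 0 - μ 2 = k
  · rw [if_pos (by rw [hk]), if_pos hk]
  · rw [if_neg hk, if_neg]
    intro h
    apply hk
    have h0 := congrFun h 0
    simpa using h0

end Adic

end Summit.HodgeConjecture.HodgeConjecture.R90.S6

end
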